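import Literature.Computability.AlgebraicComplexity.BLMW11StabilityInheritance
import HarnessLib

/-!
# BLMW 2011, Props. 5.2.1 / 5.5.2, the divisibility clauses: no stabilizer invariants in `S_πW`
# unless the degree divides `|π|` (proved)

Sibling proofs file of `BLMW11StabilityInheritance.lean` (val-lit cell, D-0074 GROUP L, row
`BLMW11-A`; P. Bürgisser, J. M. Landsberg, L. Manivel, J. Weyman, SIAM J. Comput. 40 (2011) §5.2,
§5.5). In the proof of Prop. 5.2.1 ((5.2.6), the orbit ring of `det_n`) BLMW note "Moreover, if `n`
does not divide `|π|`, then `(S_π(E ⊗ F))^{H₀} = 0`", and likewise for `per_m` (Prop. 5.5.2): the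
stabilizer of a form `f` of degree `n` contains the scalar matrices `ζ · 1` with `ζⁿ = 1`, and `ζ · 1`
acts on `S_πW ⊂ W^{⊗|π|}` by `ζ^{|π|}`, which is `≠ 1` for a primitive `n`-th root of unity `ζ` when
`n ∤ |π|`. The parent file carries these sentences as the SECOND conjuncts of the named facts
`BLMW2011_prop_5_2_1_invariants` and `BLMW2011_prop_5_5_2_invariants` (whose first conjuncts, the
dimension formulas `dim (S_πW)^{GL(W)(det_n)} = sk^π_{δⁿδⁿ}` and `dim (S_πW)^{GL(W)(per_m)} = mult_π`,
need the exact stabilizers and stay open). Here the second conjuncts are PROVED, for every form: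

* `subgroupInvariants_schurRep_linStabilizer_eq_bot` — for a form `f ∈ ℂ[x_σ]` of degree `n` and a
  partition `π ⊢ D` with `n ∤ D`, the space of `GL(W)(f)`-invariants of `S_πW`
  (`W = ℂ^σ`, `S_πW = schurRep (stdRep σ ℂ) π`) is `0`;
* `BLMW2011_prop_5_2_1_invariants_right`, `BLMW2011_prop_5_5_2_invariants_right` — the second
  conjuncts of the two named facts verbatim (`f = detFormLex ℂ n`, resp. `paddedPerFormLex ℂ m m`), and
  `BLMW2011_prop_5_2_1_invariants_iff` — the named fact is equivalent to its first conjunct (what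
  remains to be discharged), and its permanent twin `BLMW2011_prop_5_5_2_invariants_iff` (the parent
  file's `BLMW2011_prop_5_5_2_invariants` in its degree-guarded reading `0 < δ` — ERRATUM A19, cell
  `val-lit`, 2026-08-26: at `δ = 0` the typed `BLMW2011.multPer ℂ m 0 ∅` is the junk value `0`).

No definitions, no named facts (theorems only). Typed literature; `VP ≠ VNP` is not proved and nothing
here is progress on it.

## References
* [BurgisserEtAl2011] BLMW, SIAM J. Comput. 40 (2011), Prop. 5.2.1 with its proof ("if `n` does not
  divide `|π|` then `(S_π(E ⊗ F))^{H₀} = 0`"), (5.2.1) (the stabilizer of `det_n`), Prop. 5.5.2,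
  (5.5.1).
* [FultonHarrisGTM129] W. Fulton, J. Harris, *Representation Theory*, §6.1, §15.5 (scalars act on
  `S_λV ⊂ V^{⊗d}` by `t^d`).
-/

noncomputable section

open MvPolynomial

namespace Literature.Computability.AlgebraicComplexity

open _root_.Literature.NumberTheory.DiophantineGeometry
open _root_.Literature.RepresentationTheory.GeneralLinear (schurRep stdRep schurModule
  tensorDiagRep_stdRep coe_schurRep_apply)

/-! ### Scalars: in the stabilizer, and acting on `W^{⊗D}` by `c^D` -/

section Scalars

variable {σ : Type} [Fintype σ] [DecidableEq σ]

omit [Fintype σ] [DecidableEq σ] in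
/-- A form of degree `n` satisfies `f(c x) = cⁿ f(x)`: substituting `c · X_i` for `X_i` multiplies
it by `cⁿ`. (Private helper.) [folklore] -/
private theorem aeval_smul_X_eq_pow_smul {f : MvPolynomial σ ℂ} {n : ℕ} (hf : f.IsHomogeneous n)
    (c : ℂ) : aeval (fun i => c • (X i : MvPolynomial σ ℂ)) f = c ^ n • f := by
  classical
  conv_lhs => rw [f.as_sum]
  conv_rhs => rw [f.as_sum]
  rw [map_sum, Finset.smul_sum]
  refine Finset.sum_congr rfl fun d hd => ?_
  have hdeg : d.degree = n := by rw [hf.degree_eq_sum_deg_support hd, Finsupp.degree_apply]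
  rw [aeval_monomial, algebraMap_eq]
  have : (d.prod fun i e => (c • (X i : MvPolynomial σ ℂ)) ^ e) =
      C (c ^ n) * d.prod fun i e => (X i : MvPolynomial σ ℂ) ^ e := by
    simp only [smul_eq_C_mul, mul_pow, Finsupp.prod_mul, ← map_pow]
    congr 1
    rw [← map_finsuppProd]
    congr 1
    rw [← hdeg, Finsupp.degree_apply, Finsupp.prod, Finset.prod_pow_eq_pow_sum]
  rw [this, smul_eq_C_mul, monomial_eq]
  ring

/-- The scalar matrix `c · 1` acts on a form of degree `n` by `cⁿ`. (Private helper.) [folklore] -/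
private theorem linSubst_smul_one_eq_pow_smul {f : MvPolynomial σ ℂ} {n : ℕ} (hf : f.IsHomogeneous n)
    (c : ℂ) : linSubst σ ℂ (c • (1 : Matrix σ σ ℂ)) f = c ^ n • f := by
  have : linSubst σ ℂ (c • (1 : Matrix σ σ ℂ)) = aeval (fun i => c • (X i : MvPolynomial σ ℂ)) := by
    apply MvPolynomial.algHom_ext
    intro i
    rw [linSubst_X, aeval_X]
    simp only [Matrix.smul_apply, Matrix.one_apply, smul_eq_mul, mul_ite, mul_one, mul_zero,
      ite_smul, zero_smul, Finset.sum_ite_eq', Finset.mem_univ, if_true]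
  rw [this]
  exact aeval_smul_X_eq_pow_smul hf c

/-- A scalar matrix `c · 1` with `cⁿ = 1` stabilizes every form of degree `n`
(`(c · 1) · f = cⁿ f`). BLMW 2011 (5.2.1): the stabilizer of `det_n` contains these scalars.
(Private helper.) [folklore] -/
private theorem scalar_mem_linStabilizer {f : MvPolynomial σ ℂ} {n : ℕ} (hf : f.IsHomogeneous n)
    {c : ℂ} (hc : c ≠ 0) (hcn : c ^ n = 1) :
    Matrix.GeneralLinearGroup.scalar σ (Units.mk0 c hc) ∈ linStabilizer f := by
  rw [mem_linStabilizer, linSubstRep_apply, Matrix.GeneralLinearGroup.coe_scalar, Units.val_mk0,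
    Matrix.scalar_apply, ← Matrix.smul_one_eq_diagonal, linSubst_smul_one_eq_pow_smul hf c, hcn,
    one_smul]

/-- The scalar matrix `c · 1` acts on `(ℂ^σ)^{⊗D}` by `c^D` (Fulton–Harris §15.5). (Private helper.)
[folklore] -/
private theorem glTensorRep_scalar_eq_pow_smul {D : ℕ} {c : ℂ} (hc : c ≠ 0)
    (x : TensorPower ℂ D (σ → ℂ)) :
    glTensorRep σ ℂ D (Matrix.GeneralLinearGroup.scalar σ (Units.mk0 c hc)) x = (c ^ D) • x := by
  induction x using PiTensorProduct.induction_on with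
  | smul_tprod r v =>
    rw [map_smul, glTensorRep_tprod, Matrix.GeneralLinearGroup.coe_scalar, Units.val_mk0]
    have h : (fun i => (Matrix.scalar σ c).mulVec (v i)) = fun i => c • v i := by
      funext i
      rw [Matrix.scalar_apply, ← Matrix.smul_one_eq_diagonal, Matrix.smul_mulVec, Matrix.one_mulVec]
    rw [h, MultilinearMap.map_smul_univ, Finset.prod_const, Finset.card_univ, Fintype.card_fin,
      smul_comm]
  | add x y hx hy => rw [map_add, hx, hy, smul_add]

/-- A root of unity separating the degree: if `n ∤ D` there is `c ∈ ℂ^×` with `cⁿ = 1` and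
`c^D ≠ 1` (a primitive `n`-th root of unity; for `n = 0`, where `D ≠ 0`, take `c = 2`).
(Private helper.) [folklore] -/
private theorem exists_pow_eq_one_and_pow_ne_one {n D : ℕ} (h : ¬ n ∣ D) :
    ∃ c : ℂ, c ≠ 0 ∧ c ^ n = 1 ∧ c ^ D ≠ 1 := by
  rcases Nat.eq_zero_or_pos n with rfl | hn
  · refine ⟨2, two_ne_zero, pow_zero _, fun h2 => h ?_⟩
    rw [zero_dvd_iff]
    have h3 : ((2 ^ D : ℕ) : ℂ) = ((1 : ℕ) : ℂ) := by push_cast; exact h2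
    have h4 := Nat.cast_injective h3
    rcases Nat.pow_eq_one.mp h4 with h5 | h5
    · exact absurd h5 (by norm_num)
    · exact h5
  · have hζ := Complex.isPrimitiveRoot_exp n hn.ne'
    exact ⟨_, hζ.ne_zero hn.ne', hζ.pow_eq_one, fun hD => h ((hζ.pow_eq_one_iff_dvd D).mp hD)⟩

end Scalars

/-! ### The divisibility clause for an arbitrary form -/

/-- **BLMW 2011, proof of Prop. 5.2.1 ("if `n` does not divide `|π|`, then `(S_π(E ⊗ F))^{H₀} = 0`),
for an arbitrary form**: if `f ∈ ℂ[x_σ]` is a form of degree `n` and `π ⊢ D` with `n ∤ D`, then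
`S_πW` (`W = ℂ^σ`) has no non-zero vector invariant under the stabilizer `GL(W)(f)` — the scalar
`ζ · 1`, `ζ` a primitive `n`-th root of unity, lies in `GL(W)(f)` and acts on `S_πW ⊂ W^{⊗D}` by
`ζ^D ≠ 1`. [cite: BurgisserEtAl2011, Prop. 5.2.1 (proof)] -/
theorem subgroupInvariants_schurRep_linStabilizer_eq_bot {σ : Type} [Fintype σ] [DecidableEq σ]
    {f : MvPolynomial σ ℂ} {n : ℕ} (hf : f.IsHomogeneous n) {D : ℕ} (π : Nat.Partition D)
    (h : ¬ n ∣ D) :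
    subgroupInvariants (V := schurModule ℂ (σ → ℂ) π) (schurRep (stdRep σ ℂ) π) (linStabilizer f) =
      ⊥ := by
  obtain ⟨c, hc, hcn, hcD⟩ := exists_pow_eq_one_and_pow_ne_one h
  rw [Submodule.eq_bot_iff]
  intro v hv
  have hfix := (mem_subgroupInvariants_iff.mp hv) _ (scalar_mem_linStabilizer hf hc hcn)
  have hscal : ((schurRep (stdRep σ ℂ) π (Matrix.GeneralLinearGroup.scalar σ (Units.mk0 c hc)) v :
      schurModule ℂ (σ → ℂ) π) : TensorPower ℂ D (σ → ℂ)) = (c ^ D) • (v : TensorPower ℂ D (σ → ℂ)) := by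
    rw [coe_schurRep_apply, tensorDiagRep_stdRep, glTensorRep_scalar_eq_pow_smul]
  rw [hfix] at hscal
  by_contra hne
  have hne' : (v : TensorPower ℂ D (σ → ℂ)) ≠ 0 := fun h0 => hne (Submodule.coe_eq_zero.mp h0)
  exact hcD (smul_left_injective ℂ hne' (hscal.symm.trans (one_smul ℂ _).symm))

/-! ### The second conjuncts of the two named facts -/

/-- **BLMW 2011, Prop. 5.2.1, divisibility clause — the second conjunct of
`BLMW2011_prop_5_2_1_invariants` holds**: for `π ⊢ D` with `n ∤ D` the `GL(W)(det_n)`-invariants of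
`S_πW` (`W = Mat_{n×n}`) vanish ("if `n` does not divide `|π|`, then `(S_π(E ⊗ F))^{H₀} = 0`").
[cite: BurgisserEtAl2011, Prop. 5.2.1 (proof)] -/
theorem BLMW2011_prop_5_2_1_invariants_right :
    ∀ (n D : ℕ) (π : Nat.Partition D), ¬ n ∣ D →
      subgroupInvariants (schurRep (stdRep (MatIdx n) ℂ) π) (linStabilizer (detFormLex ℂ n)) = ⊥ :=
  fun n _ π h => subgroupInvariants_schurRep_linStabilizer_eq_bot (detFormLex_isHomogeneous ℂ n) π h

/-- **BLMW 2011, Prop. 5.5.2, divisibility clause — the second conjunct of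
`BLMW2011_prop_5_5_2_invariants` holds**: for `m ≥ 3` (indeed any `m ≥ 1`) and `π ⊢ D` with
`m ∤ D`, the `GL(W)(per_m)`-invariants of `S_πW` (`W = Mat_{m×m}`) vanish.
[cite: BurgisserEtAl2011, Prop. 5.5.2 (proof)] -/
theorem BLMW2011_prop_5_5_2_invariants_right :
    ∀ (m D : ℕ) [NeZero m] (π : Nat.Partition D), 3 ≤ m → ¬ m ∣ D →
      subgroupInvariants (schurRep (stdRep (MatIdx m) ℂ) π) (linStabilizer (paddedPerFormLex ℂ m m)) =
        ⊥ :=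
  fun _ _ _ π _ h =>
    subgroupInvariants_schurRep_linStabilizer_eq_bot (paddedPerFormLex_isHomogeneous ℂ le_rfl) π h

/-- **What remains of `BLMW2011_prop_5_2_1_invariants`**: the named fact is equivalent to its first
conjunct, the dimension formula `dim (S_πW)^{GL(W)(det_n)} = sk^π_{δⁿδⁿ}` (BLMW (5.2.6) via (4.1.2)).
[cite: BurgisserEtAl2011, Prop. 5.2.1 (5.2.6)] -/
theorem BLMW2011_prop_5_2_1_invariants_iff :
    BLMW2011_prop_5_2_1_invariants ↔
      ∀ (n δ : ℕ) (π : Nat.Partition (n * δ)), π.parts.card ≤ n * n →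
        Module.finrank ℂ (subgroupInvariants (schurRep (stdRep (MatIdx n) ℂ) π)
          (linStabilizer (detFormLex ℂ n))) = symKroneckerCoeff ℂ π (Nat.Partition.rectangle n δ) :=
  ⟨fun hP => hP.1, fun h1 => ⟨h1, BLMW2011_prop_5_2_1_invariants_right⟩⟩

/-- **What remains of `BLMW2011_prop_5_5_2_invariants`** (degree-guarded reading `0 < δ`, ERRATUM A19 of
the parent file): the named fact is equivalent to its first conjunct, the dimension formula
`dim (S_πW)^{GL(W)(per_m)} = mult_π` (BLMW (5.5.2) via (4.1.2)). [cite: BurgisserEtAl2011, Prop. 5.5.2 (5.5.2)] -/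
theorem BLMW2011_prop_5_5_2_invariants_iff :
    BLMW2011_prop_5_5_2_invariants ↔
      ∀ (m δ : ℕ) [NeZero m] (π : Nat.Partition (m * δ)), 3 ≤ m → 0 < δ → π.parts.card ≤ m * m →
        Module.finrank ℂ (subgroupInvariants (schurRep (stdRep (MatIdx m) ℂ) π)
          (linStabilizer (paddedPerFormLex ℂ m m))) = BLMW2011.multPer ℂ m δ π :=
  ⟨fun hP => hP.1, fun h1 => ⟨h1, BLMW2011_prop_5_5_2_invariants_right⟩⟩

end Literature.Computability.AlgebraicComplexity
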